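/-
Copyright (c) 2026 the pub-hodgecm-mathlib formalisation cell (harness21).  Prover seat hodgecm-mathlib-F0P3-p04 (g12); architect A-p16 (g30) A-130 (2) ∕ A-135 (R1):
the rider `stub_twoDeepRep_typeTwo` of the END fold `LocalTransferAtOneHyperspecialLevelTwo` v3.2 :320 (LIFT 1 → 2, hypothesis (H2D) at type (2)), 2026-09-01.
-/
import Literature.NumberTheory.Rogawski1990.TwoDeepRepresentativesTypeTwoLocal                -- ★ the `L_w`-layer (this seat): `exists_sqrtGenerator_coords`, the levels of `t₊`, `t₋`
import Literature.NumberTheory.Rogawski1990.TwoDeepRepresentativesTypeTwoOrgans               -- ★ p846569 organ (i): the `Δ‴`-support is the two matched classes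
import Literature.NumberTheory.Rogawski1990.UnitFundamentalLemmaInertFlickerFrame             -- ★ `exists_frame_of_nonsplit` (one-place model), `coe_localNonsplitEquiv_endoEmbLocal`
import Literature.NumberTheory.Rogawski1990.UnitFundamentalLemmaInertIrredClauseOfValuesStubFrame  -- ★ `mul_eq_mul_reindex_fromBlocks_of_conj_endoEmbLocal_eq` (block frame of a match)
import Literature.NumberTheory.Rogawski1990.DepthZeroKappaTransferTypeTwoGSide                 -- ★ p846592 `setOf_entrywise_deep_mem_nhds_one` (A-p12 (g22))
import Literature.NumberTheory.Rogawski1990.FinExplicitTransferFactorConjLeft                   -- ★ `finExplicitDelta_conj_left_all`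
import Literature.NumberTheory.Rogawski1990.FinExplicitTransferFactorConjRight                  -- ★ `finExplicitDelta_conj_right_all`
import Literature.NumberTheory.Automorphic.UnitaryGroupRankOneBigCell                          -- ★ `UnitaryGroup.mem_glInt_iff_forall_v_le_one`
import Literature.NumberTheory.Automorphic.LocalRegularOrbitClosed                             -- ★ `map_conjLocal_transpose_localForm`, `isUnit_det_localForm`
import HarnessLib

/-!
# 2-deep `K`-representatives of BOTH type-(2) classes near the identity (the rider `stub_twoDeepRep_typeTwo` of LIFT 1 → 2)

Topic `NumberTheory/Rogawski1990`; namespace `Literature.NumberTheory.Rogawski1990`.  THEOREMS ONLY (no `def`, no instance, no notation, no named fact, no `sorry`); kernel lane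
`--supports stmt-HodgeConjecture-24833`.  Cell `pub/hodgecm-mathlib`, crux H413; road «S3-tree», END fold `LocalTransferAtOneHyperspecialLevelTwo` v3.2 (sha16 404672a0f667a4e7)
:317–:340 = the rider **`stub_twoDeepRep_typeTwo`** (architect A-p16 (g30) A-130 (2), A-135 (R1); LEAD F0P3a-plan (g12) T11-18 (2)).  HONEST LABEL: HC_CM is proved only modulo the
cell's 2 remaining named inputs (hLiu418 24832, h413 24833) until rung 0 closes; this file pays no letter by itself.

THE STATEMENT (`exists_twoDeepRepresentative_of_finExplicitDelta_ne_zero_typeTwo`, binders∕conclusion = the fold's :320 VERBATIM).  At a finite place `v` of `L⁺` NON-SPLIT and unramified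
in the CM field `L` (`w ∣ v`, `c • w = w`), of good reduction for the hermitian `H′` and with `2 ∈ 𝒪_w^×`: there is a neighbourhood `V` of `1 ∈ H_v = U(Φ₂) × U(Φ₁)` such that for
every `G`-regular `γ_H ∈ V` of TYPE (2) (`χ_{g_w}` has no root in `L_w`) and every conjugacy class `c` of `G′_v = U(H′)(L⁺_v)` charged by `Δ‴_v(γ_H, ·)` and meeting `K′ = U(H′)(𝒪_v)`,
`c` has a representative `γ₀ ∈ K′` with `(γ₀)_w ≡ 1 (mod ϖ_v²)` entrywise in the coordinates of `H′`.

THE PROOF.  `V` = the principal level-THREE box `{|g_w − 1|, |u_w − 1| ≤ |ϖ_v³|}` (★ `setOf_entrywise_deep_mem_nhds_one`; A-127: at level 2 the `κ = −1` class can miss `K′(2)`).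
In the one-place model `e : G′_v ≃ U(σ_w, Φ₃)(L_w)`, `e(x) = T x_w T⁻¹`, `T ∈ GL₃(𝒪_w)` (★ `exists_frame_of_nonsplit`) the two classes of the stable class of `ι_v(γ_H)` are represented by
`t₊ = ι(g_w, u_w)` (3-deep) and by the LITERAL `t₋` of ★ `TypeTwoNonNormTwistExplicit` built from the rescaled `⋆`-fixed square-root generator `Π = (p q; r −p)` of `L_w[g_w]`,
`Π² = D`, `|D|_w = |ϖ_v|` (★ `TwoDeepRepresentativesTypeTwoLocal` §1: ★ `exists_nonscalar_hermStar_eq_sq_eq_smul`; the order of `D` is ODD by ★ `odd_log_valued_of_not_isSquare` — the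
ramification of `K₁⁺∕L⁺_v` — and is normalised to `1` by a power of `ϖ_v`): `t₋ ∈ U(Φ₃)`, `t₋` is `GL₃(L_w)`-conjugate to `t₊` (so both MATCH `γ_H`), `t₋` is NOT `U(Φ₃)`-conjugate to `t₊` (its Cartan corner `−D` has odd
order, while `|σ(y)y| = |y|²`), and `t₋ ≡ 1 (mod ϖ_v²)` since `|φ₀ − 1|, |φ₁|, |u − 1| ≤ |ϖ_v³|` (★ `…Local` §2; the entry `(φ₀ − u)∕4D` loses exactly one level).  Pull both back
along `e` (§3: `K′`-membership and the level are read through `T ∈ GL₃(𝒪_w)`), and conclude with ★ organ (i) `mk_eq_or_of_finExplicitDelta_out_ne_zero_typeTwo`: a charged class is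
`⟦γ₊⟧` or `⟦γ₋⟧` (§4).

## References
* [Rogawski1990] J. D. Rogawski, *Automorphic Representations of Unitary Groups in Three Variables*, Ann. of Math. Stud. 123 (1990), §3.5 Prop. 3.5.2 (a)(c) p. 29, §3.6 p. 31,
  §4.3 p. 43, §4.9 Prop. 4.9.1 p. 55, §14.2 p. 233.
* [Flicker1998UnitaryFL] Y. Z. Flicker, *Elementary proof of the fundamental lemma for a unitary group*, Canad. J. Math. 50 (1998), Prop. 3 p. 78, §6 p. 97.
* [Jacobowitz1962] R. Jacobowitz, *Hermitian forms over local fields*, Amer. J. Math. 84 (1962), §7 Thm. 7.1.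
* [Serre1979] J.-P. Serre, *Local Fields* (1979), Ch. II §1, Ch. XIV §4.
-/

set_option autoImplicit false

noncomputable section

open NumberField IsDedekindDomain Matrix Topology Filter
open Literature.NumberTheory.Automorphic Literature.NumberTheory.Automorphic.UnitaryGroup
open Literature.NumberTheory.Automorphic.IntegralReduction Literature.NumberTheory.GaloisRepresentations
open Literature.NumberTheory.LocalFields.UnramifiedQuadraticNorm
open Literature.AlgebraicGeometry.ShimuraVarieties (unitaryGroup)
open scoped MatrixGroups ValuativeRel

namespace Literature.NumberTheory.Rogawski1990

section Setup

variable (L : Type) [Field L] [NumberField L] [IsCMField L] {v : HeightOneSpectrum (𝓞 ↥(maximalRealSubfield L))}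
  (w : PlacesOver L v) (hw : IsCMField.complexConj L • w.1 = w.1)

/-! ## §3 The two matched `K′`-representatives in `G′_v`, pulled back along the one-place model `e : G′_v ≃ U(σ_w, Φ₃)(L_w)` -/

section Frame

variable (H' : Matrix (Fin 3) (Fin 3) L)

/-- `|c⁻¹ x| ≤ 1` from `|x| ≤ |c|` (`c ≠ 0`). [cite: Serre1979, Ch. II §1] -/
theorem valued_inv_mul_le_one {K : Type*} [Field K] [Valued K (WithZero (Multiplicative ℤ))] {c x : K} (hc : c ≠ 0) (h : Valued.v x ≤ Valued.v c) :
    Valued.v (c⁻¹ * x) ≤ 1 := by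
  have hvc : Valued.v c ≠ 0 := (Valuation.ne_zero_iff _).2 hc
  rw [map_mul, map_inv₀]
  calc (Valued.v c)⁻¹ * Valued.v x ≤ (Valued.v c)⁻¹ * Valued.v c := mul_le_mul' le_rfl h
    _ = 1 := inv_mul_cancel₀ hvc

set_option maxHeartbeats 1600000 in
include hw in
/-- **THE TWO MATCHED 2-DEEP `K′`-REPRESENTATIVES AT A 3-DEEP TYPE-(2) `γ_H`.**  At a non-split unramified `w ∣ v` of good reduction for `H′`, `2 ∈ 𝒪_w^×`: if `γ_H = (g, u) ∈ H_v` has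
`|g_w − 1|, |u_w − 1| ≤ |ϖ_v³|` entrywise and `χ_{g_w}` has no root in `L_w`, then there are `γ₊, γ₋ ∈ K′ = U(H′)(𝒪_v)` both MATCHING `γ_H` (★ `IsLocalNormPair`), NOT conjugate in
`G′_v`, with `(γ_±)_w ≡ 1 (mod ϖ_v²)` entrywise in the coordinates of `H′` — `e γ₊ = ι(g_w, u_w)` and `e γ₋ = t₋` (★ `TypeTwoNonNormTwistExplicit`) in the one-place model
`e g = T g_w T⁻¹`, `T ∈ GL₃(𝒪_w)` (★ `exists_frame_of_nonsplit`). [cite: Rogawski1990, §3.5 Prop. 3.5.2 (c) p. 29; §3.6 p. 31; §4.9 p. 55; §14.2 p. 233]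
[cite: Flicker1998UnitaryFL, §6 p. 97] -/
theorem exists_matched_pair_twoDeep_typeTwo (hH' : (H'.map (cmConjRingHom L)).transpose = H') (hv : Algebra.IsUnramifiedIn (𝓞 L) v.asIdeal)
    (hH'w : IsUnit (placeForm H' w.1)) (hH'i : hH'w.unit ∈ glInt 3 (w.1.adicCompletion L)) (h2 : IsUnit (2 : 𝒪[w.1.adicCompletion L]))
    (γH : (cmDatum L 2 (Matrix.of fun i j : Fin 2 => if i.val + j.val + 1 = 2 then (1 : L) else 0)).Local v ×
      (cmDatum L 1 (Matrix.of fun i j : Fin 1 => if i.val + j.val + 1 = 1 then (1 : L) else 0)).Local v)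
    (hg3 : ∀ i j, Valued.v ((((γH.1.val : GL (Fin 2) (LocalRing L v)).val.map (Pi.evalRingHom (fun w' : PlacesOver L v => w'.1.adicCompletion L) w)) - 1) i j) ≤
      Valued.v ((toPlace v w (HeckeCharacter.uniformizer ↥(maximalRealSubfield L) v : v.adicCompletion ↥(maximalRealSubfield L))) ^ 3))
    (hu3 : Valued.v (finGammaTwo L v γH w - 1) ≤
      Valued.v ((toPlace v w (HeckeCharacter.uniformizer ↥(maximalRealSubfield L) v : v.adicCompletion ↥(maximalRealSubfield L))) ^ 3))
    (hroot : ¬ ∃ x : w.1.adicCompletion L, (((γH.1.val : GL (Fin 2) (UnitaryGroup.LocalRing L v)).val.map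
          (Pi.evalRingHom (fun w' : PlacesOver L v => w'.1.adicCompletion L) w)).charpoly).IsRoot x) :
    ∃ γp γm : (cmDatum L 3 H').Local v,
      IsLocalNormPair L H' v γH γp ∧ IsLocalNormPair L H' v γH γm ∧ ¬ IsConj γp γm ∧
      γp ∈ cmLocalIntegralLevel L 3 H' v ∧ γm ∈ cmLocalIntegralLevel L 3 H' v ∧
      (∀ a b, Valued.v (((toPlace v w (HeckeCharacter.uniformizer ↥(maximalRealSubfield L) v : v.adicCompletion ↥(maximalRealSubfield L))) ^ 2)⁻¹ *
        ((((localNonsplitEquiv (IsCMField.complexConj L) H' (IsCMField.complexConj_ne_one L) w hw γp :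
            ↥(unitaryGroupOfForm (galAdicCompletionMap (L := L) (IsCMField.complexConj L) hw) (placeForm H' w.1))) : GL (Fin 3) (w.1.adicCompletion L)) :
              Matrix (Fin 3) (Fin 3) (w.1.adicCompletion L)) a b - (1 : Matrix (Fin 3) (Fin 3) (w.1.adicCompletion L)) a b)) ≤ 1) ∧
      (∀ a b, Valued.v (((toPlace v w (HeckeCharacter.uniformizer ↥(maximalRealSubfield L) v : v.adicCompletion ↥(maximalRealSubfield L))) ^ 2)⁻¹ *
        ((((localNonsplitEquiv (IsCMField.complexConj L) H' (IsCMField.complexConj_ne_one L) w hw γm :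
            ↥(unitaryGroupOfForm (galAdicCompletionMap (L := L) (IsCMField.complexConj L) hw) (placeForm H' w.1))) : GL (Fin 3) (w.1.adicCompletion L)) :
              Matrix (Fin 3) (Fin 3) (w.1.adicCompletion L)) a b - (1 : Matrix (Fin 3) (Fin 3) (w.1.adicCompletion L)) a b)) ≤ 1) := by
  have hc := IsCMField.complexConj_ne_one L
  set σ := galAdicCompletionMap (L := L) (IsCMField.complexConj L) hw with hσdef
  set ϖ : w.1.adicCompletion L := toPlace v w (HeckeCharacter.uniformizer ↥(maximalRealSubfield L) v : v.adicCompletion ↥(maximalRealSubfield L)) with hϖdef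
  have hϖv : Valued.v ϖ = WithZero.exp (-1 : ℤ) := valued_toPlace_uniformizer L v w hv
  have hϖ0 : ϖ ≠ 0 := toPlace_uniformizer_ne_zero L v w hv
  have hϖ20 : ϖ ^ 2 ≠ 0 := pow_ne_zero 2 hϖ0
  have h2v : Valued.v (2 : w.1.adicCompletion L) = 1 := (isUnit_two_integer_iff_valued_eq_one L w.1).1 h2
  have h20 : (2 : w.1.adicCompletion L) ≠ 0 := fun h0 => by rw [h0, map_zero] at h2v; exact zero_ne_one h2v
  have hσv : ∀ x, Valued.v (σ x) = Valued.v x := fun x => valued_galAdicCompletionMap L (IsCMField.complexConj L) hw x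
  -- the frame
  have hH'c : (H'.map (IsCMField.complexConj L))ᵀ = H' := by
    have e : H'.map (IsCMField.complexConj L) = H'.map (cmConjRingHom L) := by
      ext i j; simp [Matrix.map_apply, cmConjRingHom_apply]
    rw [e]; exact hH'
  obtain ⟨T, e, hT, he, heK, heN⟩ := exists_frame_of_nonsplit L H' hH'c w hw hv hH'w hH'i
  have hTint : ∀ a b, Valued.v ((T : Matrix (Fin 3) (Fin 3) (w.1.adicCompletion L)) a b) ≤ 1 := fun a b =>
    (v_le_one_iff_valuation_le_one _).2 ((Valuation.mem_integer_iff _ _).1 (((mem_glInt_iff _).1 hT).1 a b))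
  have hTiint : ∀ a b, Valued.v (((T⁻¹ : GL (Fin 3) (w.1.adicCompletion L)) : Matrix (Fin 3) (Fin 3) (w.1.adicCompletion L)) a b) ≤ 1 := fun a b =>
    (v_le_one_iff_valuation_le_one _).2 ((Valuation.mem_integer_iff _ _).1 (((mem_glInt_iff _).1 hT).2 a b))
  -- the `H`-side matrices at `w`
  set g : Matrix (Fin 2) (Fin 2) (w.1.adicCompletion L) :=
    ((γH.1.val : GL (Fin 2) (LocalRing L v)).val.map (Pi.evalRingHom (fun w' : PlacesOver L v => w'.1.adicCompletion L) w)) with hgdef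
  set u : w.1.adicCompletion L := finGammaTwo L v γH w with hudef
  -- the one-place images of `γ_H.1`, `γ_H.2` as elements of `GL₂(L_w)`, `GL₁(L_w)` (their matrices are `g`, `(u)` by `rfl`)
  obtain ⟨g₁, hg₁⟩ : ∃ g₁ : GL (Fin 2) (w.1.adicCompletion L), g₁ = ((localNonsplitEquiv (IsCMField.complexConj L)
      (Matrix.of fun i j : Fin 2 => if i.val + j.val + 1 = 2 then (1 : L) else 0) hc w hw γH.1 :
      unitaryGroupOfForm σ (placeForm (Matrix.of fun i j : Fin 2 => if i.val + j.val + 1 = 2 then (1 : L) else 0) w.1)) :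
      GL (Fin 2) (w.1.adicCompletion L)) := ⟨_, rfl⟩
  obtain ⟨g₂, hg₂⟩ : ∃ g₂ : GL (Fin 1) (w.1.adicCompletion L), g₂ = ((localNonsplitEquiv (IsCMField.complexConj L)
      (Matrix.of fun i j : Fin 1 => if i.val + j.val + 1 = 1 then (1 : L) else 0) hc w hw γH.2 :
      unitaryGroupOfForm σ (placeForm (Matrix.of fun i j : Fin 1 => if i.val + j.val + 1 = 1 then (1 : L) else 0) w.1)) :
      GL (Fin 1) (w.1.adicCompletion L)) := ⟨_, rfl⟩
  have hg₁g : (g₁ : Matrix (Fin 2) (Fin 2) (w.1.adicCompletion L)) = g := by rw [hg₁]; rfl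
  have hg₂u : (g₂ : Matrix (Fin 1) (Fin 1) (w.1.adicCompletion L)) 0 0 = u := by rw [hg₂]; rfl
  have hg₁U : g₁ ∈ unitaryGroupOfForm σ (placeForm (Matrix.of fun i j : Fin 2 => if i.val + j.val + 1 = 2 then (1 : L) else 0) w.1) := by
    rw [hg₁]; exact (localNonsplitEquiv (IsCMField.complexConj L) (Matrix.of fun i j : Fin 2 => if i.val + j.val + 1 = 2 then (1 : L) else 0) hc w hw γH.1).2
  have hg₂U : g₂ ∈ unitaryGroupOfForm σ (placeForm (Matrix.of fun i j : Fin 1 => if i.val + j.val + 1 = 1 then (1 : L) else 0) w.1) := by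
    rw [hg₂]; exact (localNonsplitEquiv (IsCMField.complexConj L) (Matrix.of fun i j : Fin 1 => if i.val + j.val + 1 = 1 then (1 : L) else 0) hc w hw γH.2).2
  have hgu : (g.map σ)ᵀ * !![(0 : w.1.adicCompletion L), 1; 1, 0] * g = !![(0 : w.1.adicCompletion L), 1; 1, 0] := by
    have h := mem_unitaryGroupOfForm_iff.1 hg₁U
    rw [placeForm_antidiagOne, stdForm_antidiagonal_two_over_eq, hg₁g] at h
    exact h
  have hu1 : σ u * u = 1 := by
    have h := mem_unitaryGroupOfForm_iff.1 hg₂U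
    have h1 : (StdForm.antidiagonal 1).over (w.1.adicCompletion L) = !![(1 : w.1.adicCompletion L)] := by
      ext i j; fin_cases i; fin_cases j; simp [StdForm.over, StdForm.antidiagonal_J_apply]
    rw [placeForm_antidiagOne, h1] at h
    have h00 := congrArg (fun M => M 0 0) h
    simp [Matrix.mul_apply] at h00
    rw [← hg₂u]
    linear_combination h00
  have hA : ∀ x : w.1.adicCompletion L, g.charpoly.eval x ≠ 0 := fun x hx => hroot ⟨x, hx⟩
  -- §1: the coordinates
  obtain ⟨p, q, r, D, φ₀, φ₁, hp, hq, hr, hσD, hD, hr0, hvD, hglit, R1, R2⟩ := exists_sqrtGenerator_coords L w hw hv h2v g hgu hA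
  have hD0 : D ≠ 0 := fun h0 => by rw [h0, map_zero] at hvD; exact hϖ0 ((Valuation.zero_iff _).1 hvD.symm)
  have hι : (2 : w.1.adicCompletion L) * 2⁻¹ = 1 := mul_inv_cancel₀ h20
  have hDi : D * D⁻¹ = 1 := mul_inv_cancel₀ hD0
  have hri : r * r⁻¹ = 1 := mul_inv_cancel₀ hr0
  have hσι : σ 2⁻¹ = 2⁻¹ := by rw [map_inv₀, map_ofNat]
  have hσDi : σ D⁻¹ = D⁻¹ := by rw [map_inv₀, hσD]
  have hσri : σ r⁻¹ = r⁻¹ := by rw [map_inv₀, hr]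
  -- §2: the levels
  have hg3' : ∀ i j, Valued.v (((!![φ₀ + φ₁ * p, φ₁ * q; φ₁ * r, φ₀ - φ₁ * p] : Matrix (Fin 2) (Fin 2) (w.1.adicCompletion L)) - 1) i j) ≤
      Valued.v (ϖ ^ 3) := by rw [← hglit]; exact hg3
  obtain ⟨hφ₀, hφ₁⟩ := valued_coords_of_entrywise_deep hD hvD hϖv h2v hg3'
  have htm := valued_twistRep_sub_one_le hvD hϖv h2v hφ₀ hφ₁ hu3
  have htp := valued_pattern_sub_one_le hϖv g u hg3 hu3
  -- the matrices `t₊ = ι(g, u)` and `t₋`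
  set tp : Matrix (Fin 3) (Fin 3) (w.1.adicCompletion L) := !![g 0 0, 0, g 0 1; 0, u, 0; g 1 0, 0, g 1 1] with htpdef
  set tm : Matrix (Fin 3) (Fin 3) (w.1.adicCompletion L) :=
    !![(u + φ₀) * 2⁻¹, φ₁ * 2⁻¹, (φ₀ - u) * 2⁻¹ * 2⁻¹ * D⁻¹; φ₁ * D, φ₀, φ₁ * 2⁻¹; D * (φ₀ - u), D * φ₁, (u + φ₀) * 2⁻¹] with htmdef
  have htplit : tp = !![φ₀ + φ₁ * p, 0, φ₁ * q; 0, u, 0; φ₁ * r, 0, φ₀ - φ₁ * p] := by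
    rw [htpdef, hglit]
    ext i j; fin_cases i <;> fin_cases j <;> rfl
  have hΦ₃ : placeForm (Matrix.of fun i j : Fin 3 => if i.val + j.val + 1 = 3 then (1 : L) else 0) w.1 =
      !![(0 : w.1.adicCompletion L), 0, 1; 0, 1, 0; 1, 0, 0] := by
    rw [placeForm_antidiagOne, stdForm_antidiagonal_three_over_eq]
  have htmU : (tm.map σ)ᵀ * !![(0 : w.1.adicCompletion L), 0, 1; 0, 1, 0; 1, 0, 0] * tm = !![(0 : w.1.adicCompletion L), 0, 1; 0, 1, 0; 1, 0, 0] :=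
    twistRep_unitary σ hι hDi hσD hσι hσDi R1 R2 hu1
  have htmdet : tm.det ≠ 0 := by
    intro h0
    have h := congrArg Matrix.det htmU
    rw [Matrix.det_mul, Matrix.det_mul, h0, mul_zero] at h
    have h3 : ((!![(0 : w.1.adicCompletion L), 0, 1; 0, 1, 0; 1, 0, 0] : Matrix (Fin 3) (Fin 3) (w.1.adicCompletion L))).det = -1 := by
      simp [Matrix.det_fin_three]
    rw [h3] at h
    exact one_ne_zero (neg_eq_zero.1 h.symm)
  -- the `GL₃(L_w)` elements
  obtain ⟨Tp, hTpdef⟩ : ∃ Tp : GL (Fin 3) (w.1.adicCompletion L), Tp = endoGL (g₁, g₂) := ⟨_, rfl⟩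
  have hTpmat : (Tp : Matrix (Fin 3) (Fin 3) (w.1.adicCompletion L)) = tp := by
    rw [hTpdef, coe_endoGL_eq, htpdef, hg₁g, hg₂u]
  have hTpU : Tp ∈ unitaryGroupOfForm σ (placeForm (Matrix.of fun i j : Fin 3 => if i.val + j.val + 1 = 3 then (1 : L) else 0) w.1) := by
    have h := coe_localNonsplitEquiv_endoEmbLocal L w hw γH
    rw [hTpdef, hg₁, hg₂, ← h]
    exact (localNonsplitEquiv (IsCMField.complexConj L) (Matrix.of fun i j : Fin 3 => if i.val + j.val + 1 = 3 then (1 : L) else 0) hc w hw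
      (endoEmbLocal L v γH)).2
  set Tm : GL (Fin 3) (w.1.adicCompletion L) := Matrix.GeneralLinearGroup.mkOfDetNeZero tm htmdet with hTmdef
  have hTmmat : (Tm : Matrix (Fin 3) (Fin 3) (w.1.adicCompletion L)) = tm := rfl
  have hTmU : Tm ∈ unitaryGroupOfForm σ (placeForm (Matrix.of fun i j : Fin 3 => if i.val + j.val + 1 = 3 then (1 : L) else 0) w.1) := by
    rw [mem_unitaryGroupOfForm_iff, hΦ₃, hTmmat]
    exact htmU
  -- `t₋ = Y t₊ Y⁻¹` in `GL₃(L_w)`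
  set Y : Matrix (Fin 3) (Fin 3) (w.1.adicCompletion L) := !![(0 : w.1.adicCompletion L), 2⁻¹, 2⁻¹ * r⁻¹; 1, 0, -(p * r⁻¹); 0, -D, D * r⁻¹] with hYdef
  set Yi : Matrix (Fin 3) (Fin 3) (w.1.adicCompletion L) := !![p, 1, p * 2⁻¹ * D⁻¹; 1, 0, -(2⁻¹ * D⁻¹); r, 0, r * 2⁻¹ * D⁻¹] with hYidef
  have hYYi : Y * Yi = 1 := twistConj_mul_inv hι hDi hri
  have hYiY : Yi * Y = 1 := twistConjInv_mul hι hDi hri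
  set Ygl : GL (Fin 3) (w.1.adicCompletion L) := ⟨Y, Yi, hYYi, hYiY⟩ with hYgldef
  have hconjGL : Ygl * Tp * Ygl⁻¹ = Tm := by
    apply Units.ext
    simp only [Units.val_mul]
    rw [hTpmat, hTmmat, htplit]
    show Y * _ * Yi = tm
    rw [twistConj_mul_pattern_eq hD hι hDi hri, Matrix.mul_assoc, hYYi, Matrix.mul_one]
  have hconjGL' : IsConj Tp Tm := isConj_iff.2 ⟨Ygl, hconjGL⟩
  -- NOT conjugate inside `U(Φ₃)`
  have hdet : (φ₀ + φ₁ * p - u) * (φ₀ - φ₁ * p - u) - φ₁ * q * (φ₁ * r) ≠ 0 := by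
    have h := hA u
    rw [hglit, Matrix.eval_charpoly, Matrix.det_fin_two] at h
    intro h0; apply h
    simp [Matrix.scalar_apply, Matrix.sub_apply, Matrix.diagonal]
    linear_combination h0
  have hnotU : ¬ IsConj (⟨Tp, hTpU⟩ : ↥(unitaryGroupOfForm σ (placeForm (Matrix.of fun i j : Fin 3 => if i.val + j.val + 1 = 3 then (1 : L) else 0) w.1)))
      ⟨Tm, hTmU⟩ := by
    intro hcj
    obtain ⟨k, hk⟩ := isConj_iff.1 hcj
    have hk' : (k : GL (Fin 3) (w.1.adicCompletion L)) * Tp = Tm * (k : GL (Fin 3) (w.1.adicCompletion L)) := by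
      have h := congrArg Subtype.val hk
      simp only [Subgroup.coe_mul, InvMemClass.coe_inv] at h
      rw [← h]; group
    obtain ⟨kM, hkM⟩ : ∃ kM : Matrix (Fin 3) (Fin 3) (w.1.adicCompletion L),
        kM = ((k : GL (Fin 3) (w.1.adicCompletion L)) : Matrix (Fin 3) (Fin 3) (w.1.adicCompletion L)) := ⟨_, rfl⟩
    have hkmat : kM * tp = tm * kM := by
      have h := congrArg (fun x : GL (Fin 3) (w.1.adicCompletion L) => (x : Matrix (Fin 3) (Fin 3) (w.1.adicCompletion L))) hk'
      simp only [Units.val_mul, hTpmat, hTmmat] at h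
      rw [hkM]; exact h
    have hkU : (kM.map σ)ᵀ * !![(0 : w.1.adicCompletion L), 0, 1; 0, 1, 0; 1, 0, 0] * kM = !![(0 : w.1.adicCompletion L), 0, 1; 0, 1, 0; 1, 0, 0] := by
      have h := mem_unitaryGroupOfForm_iff.1 k.2
      rw [← hkM, hΦ₃] at h
      exact h
    rw [htplit] at hkmat
    obtain ⟨y, hy⟩ := exists_norm_eq_neg_of_unitary_conj σ hp hσD hσι hσri hD hι hDi hri hdet hkU hkmat
    -- `|σ(y) y| = |y|²` is an even power of `exp 1`, `|−D| = exp(−1)` is odd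
    have hvy : Valued.v y * Valued.v y = WithZero.exp (-1 : ℤ) := by
      have e1 : Valued.v (σ y * y) = Valued.v y * Valued.v y := by rw [map_mul, hσv]
      rw [← e1, hy, Valuation.map_neg, hvD, hϖv]
    by_cases hy0 : y = 0
    · rw [hy0, map_zero, mul_zero] at hvy
      exact WithZero.zero_ne_coe hvy
    · have hv0 : Valued.v y ≠ 0 := (Valuation.ne_zero_iff _).2 hy0
      set n : ℤ := WithZero.log (Valued.v y) with hn
      have hvn : Valued.v y = WithZero.exp n := by rw [hn, WithZero.exp_log hv0]
      rw [hvn, ← WithZero.exp_add, WithZero.exp_inj] at hvy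
      omega
  -- the two elements of `G′_v`
  refine ⟨e.symm ⟨Tp, hTpU⟩, e.symm ⟨Tm, hTmU⟩, ?_, ?_, ?_, ?_, ?_, ?_, ?_⟩
  · rw [heN, ContinuousMulEquiv.apply_symm_apply, ← hg₁, ← hg₂, ← hTpdef]
  · rw [heN, ContinuousMulEquiv.apply_symm_apply, ← hg₁, ← hg₂, ← hTpdef]
    exact hconjGL'
  · intro hcj
    apply hnotU
    have h : IsConj (e (e.symm ⟨Tp, hTpU⟩)) (e (e.symm ⟨Tm, hTmU⟩)) := MonoidHom.map_isConj e.toMonoidHom hcj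
    rwa [ContinuousMulEquiv.apply_symm_apply, ContinuousMulEquiv.apply_symm_apply] at h
  · rw [heK, ContinuousMulEquiv.apply_symm_apply]
    exact (Literature.NumberTheory.Automorphic.UnitaryGroup.mem_glInt_iff_forall_v_le_one σ (placeForm_antidiagOne 3 w.1) hσv ⟨Tp, hTpU⟩).2
      (by rw [hTpmat]; exact valued_apply_le_one_of_sub_one_le hϖv tp htp)
  · rw [heK, ContinuousMulEquiv.apply_symm_apply]
    exact (Literature.NumberTheory.Automorphic.UnitaryGroup.mem_glInt_iff_forall_v_le_one σ (placeForm_antidiagOne 3 w.1) hσv ⟨Tm, hTmU⟩).2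
      (by rw [hTmmat]; exact valued_apply_le_one_of_sub_one_le hϖv tm htm)
  · have hloc : ((localNonsplitEquiv (IsCMField.complexConj L) H' hc w hw (e.symm ⟨Tp, hTpU⟩) :
        ↥(unitaryGroupOfForm σ (placeForm H' w.1))) : GL (Fin 3) (w.1.adicCompletion L)) = T⁻¹ * Tp * T := by
      have h := he (e.symm ⟨Tp, hTpU⟩)
      rw [ContinuousMulEquiv.apply_symm_apply] at h
      have h' : (Tp : GL (Fin 3) (w.1.adicCompletion L)) = T * _ * T⁻¹ := h
      calc _ = T⁻¹ * (T * ((localNonsplitEquiv (IsCMField.complexConj L) H' hc w hw (e.symm ⟨Tp, hTpU⟩) :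
            ↥(unitaryGroupOfForm σ (placeForm H' w.1))) : GL (Fin 3) (w.1.adicCompletion L)) * T⁻¹) * T := by group
        _ = T⁻¹ * Tp * T := by rw [← h']
    intro a b
    refine valued_inv_mul_le_one hϖ20 ?_
    rw [← Matrix.sub_apply, hloc, Units.val_mul, Units.val_mul, hTpmat]
    exact valued_conj_sub_one_le T hTint hTiint tp htp a b
  · have hloc : ((localNonsplitEquiv (IsCMField.complexConj L) H' hc w hw (e.symm ⟨Tm, hTmU⟩) :
        ↥(unitaryGroupOfForm σ (placeForm H' w.1))) : GL (Fin 3) (w.1.adicCompletion L)) = T⁻¹ * Tm * T := by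
      have h := he (e.symm ⟨Tm, hTmU⟩)
      rw [ContinuousMulEquiv.apply_symm_apply] at h
      have h' : (Tm : GL (Fin 3) (w.1.adicCompletion L)) = T * _ * T⁻¹ := h
      calc _ = T⁻¹ * (T * ((localNonsplitEquiv (IsCMField.complexConj L) H' hc w hw (e.symm ⟨Tm, hTmU⟩) :
            ↥(unitaryGroupOfForm σ (placeForm H' w.1))) : GL (Fin 3) (w.1.adicCompletion L)) * T⁻¹) * T := by group
        _ = T⁻¹ * Tm * T := by rw [← h']
    intro a b
    refine valued_inv_mul_le_one hϖ20 ?_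
    rw [← Matrix.sub_apply, hloc, Units.val_mul, Units.val_mul, hTmmat]
    exact valued_conj_sub_one_le T hTint hTiint tm htm a b

end Frame

end Setup

/-! ## §4 The rider `stub_twoDeepRep_typeTwo` (END fold v3.2 :320 VERBATIM) -/

/-- **RIDER (H2D), TYPE (2) «2-DEEP REPRESENTATIVES»** — the END fold's `stub_twoDeepRep_typeTwo` :320 VERBATIM: near `1 ∈ H_v`, at type-(2) `G`-regular `γ_H`
(`χ_{g_w}` rootless), every `G′_v`-class `c` with `Δ‴_v(γ_H, out c) ≠ 0` meeting `K′` has a representative `γ₀ ∈ K′` with `(γ₀)_w ≡ 1 (mod ϖ_v²)` in the coordinates of `H′`.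
`V` = the 3-deep box (★ `setOf_entrywise_deep_mem_nhds_one`); the charged classes are `⟦γ₊⟧, ⟦γ₋⟧` (★ organ (i) `mk_eq_or_of_finExplicitDelta_out_ne_zero_typeTwo` over the block
frame of the match `γ₊`, ★ `mul_eq_mul_reindex_fromBlocks_of_conj_endoEmbLocal_eq`, ★ `irreducible_charpoly_of_not_exists_isRoot_eval`), both represented 2-deep in `K′` by §3.
(The hypotheses `IsLocalGRegular`, `hμ`, `hμu`, `hμω` and «`c` meets `K′`» are not needed.) [cite: Rogawski1990, §4.9 Prop. 4.9.1 p. 55; §4.3 p. 43; §3.5 Prop. 3.5.2 (c) p. 29]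
[cite: Flicker1998UnitaryFL, §6 p. 97] -/
theorem exists_twoDeepRepresentative_of_finExplicitDelta_ne_zero_typeTwo
    (L : Type) [Field L] [NumberField L] [IsCMField L] (H' : Matrix (Fin 3) (Fin 3) L) (μ : HeckeCharacter L)
    {v : HeightOneSpectrum (𝓞 ↥(maximalRealSubfield L))}
    (hH' : (H'.map (cmConjRingHom L)).transpose = H') (w : PlacesOver L v)
    (hw : IsCMField.complexConj L • w.1 = w.1) (hv : Algebra.IsUnramifiedIn (𝓞 L) v.asIdeal)
    (hH'w : IsUnit (placeForm H' w.1)) (hH'i : hH'w.unit ∈ glInt 3 (w.1.adicCompletion L))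
    (_hμ : μ.IsUnramifiedAt w.1) (_hμu : μ.IsUnitary)
    (_hμω : ∀ x : ideleGroup ↥(maximalRealSubfield L), μ (AdeleRing.ideleBaseChange ↥(maximalRealSubfield L) L x) = quadraticHeckeCharCM L x)
    (h2 : IsUnit (2 : 𝒪[w.1.adicCompletion L])) :
    ∃ V ∈ 𝓝 (1 : ((cmDatum L 2 (Matrix.of fun i j : Fin 2 => if i.val + j.val + 1 = 2 then (1 : L) else 0)).Local v × (cmDatum L 1 (Matrix.of fun i j : Fin 1 => if i.val + j.val + 1 = 1 then (1 : L) else 0)).Local v)), ∀ γH ∈ V, IsLocalGRegular L v γH →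
      ¬ (∃ x : w.1.adicCompletion L, (((γH.1.val : GL (Fin 2) (UnitaryGroup.LocalRing L v)).val.map
          (Pi.evalRingHom (fun w' : PlacesOver L v => w'.1.adicCompletion L) w)).charpoly).IsRoot x) →
      (∀ cG : ConjClasses ((cmDatum L 3 H').Local v),
          ((finExplicitCollection L H' μ (finExplicitDelta_conj_left_all L H' μ) (finExplicitDelta_conj_right_all L H' μ)) v).Δ γH (Quotient.out cG) ≠ 0 →
          (∃ z ∈ cmLocalIntegralLevel L 3 H' v, ConjClasses.mk z = cG) →
          ∃ γ₀ : ((cmDatum L 3 H').Local v), ConjClasses.mk γ₀ = cG ∧ γ₀ ∈ cmLocalIntegralLevel L 3 H' v ∧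
            (∀ a b, Valued.v (((toPlace v w (HeckeCharacter.uniformizer ↥(maximalRealSubfield L) v : v.adicCompletion ↥(maximalRealSubfield L))) ^ 2)⁻¹ *
        ((((localNonsplitEquiv (IsCMField.complexConj L) H' (IsCMField.complexConj_ne_one L) w hw (γ₀) :
            ↥(unitaryGroupOfForm (galAdicCompletionMap (L := L) (IsCMField.complexConj L) hw) (placeForm H' w.1))) : GL (Fin 3) (w.1.adicCompletion L)) :
              Matrix (Fin 3) (Fin 3) (w.1.adicCompletion L)) a b - (1 : Matrix (Fin 3) (Fin 3) (w.1.adicCompletion L)) a b)) ≤ 1)) := by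
  classical
  have hϖ0 := toPlace_uniformizer_ne_zero L v w hv
  have hc3 : (toPlace v w (HeckeCharacter.uniformizer ↥(maximalRealSubfield L) v : v.adicCompletion ↥(maximalRealSubfield L))) ^ 3 ≠ 0 :=
    pow_ne_zero 3 hϖ0
  refine ⟨_, setOf_entrywise_deep_mem_nhds_one L v w hc3, ?_⟩
  intro γH hγ _hreg hroot cG hΔ _hK
  obtain ⟨γp, γm, hp, hm, hne, hpK, hmK, hpv, hmv⟩ :=
    exists_matched_pair_twoDeep_typeTwo L w hw H' hH' hv hH'w hH'i h2 γH hγ.1 hγ.2 hroot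
  -- the block frame of the match `γ₊`, for organ (i)
  have hA : Irreducible ((γH.1.val : GL (Fin 2) (UnitaryGroup.LocalRing L v)).val.charpoly) :=
    irreducible_charpoly_of_not_exists_isRoot_eval L v w hw _ hroot
  have hH := map_conjLocal_transpose_localForm L 3 H' v hH'
  have hdet : H'.det ≠ 0 := by
    intro h0
    have hu := (Matrix.isUnit_iff_isUnit_det _).1 hH'w
    have e : (placeForm H' w.1).det = algebraMap L (w.1.adicCompletion L) H'.det :=
      (RingHom.map_det (algebraMap L (w.1.adicCompletion L)) H').symm
    rw [e, h0, map_zero] at hu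
    exact not_isUnit_zero hu
  have hHd := isUnit_det_localForm L 3 H' v hdet
  obtain ⟨c, hc⟩ := isConj_iff.1 hp
  have hP := mul_eq_mul_reindex_fromBlocks_of_conj_endoEmbLocal_eq L H' γH hc
  have hΔ' : finExplicitDelta L v H' γH μ (Quotient.out cG) ≠ 0 := by rwa [finExplicitCollection_Δ] at hΔ
  rcases mk_eq_or_of_finExplicitDelta_out_ne_zero_typeTwo L v H' γH w hw μ hp hm hH hHd endoPerm hP hA hne cG hΔ' with h | h
  · exact ⟨γp, h.symm, hpK, hpv⟩
  · exact ⟨γm, h.symm, hmK, hmv⟩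

end Literature.NumberTheory.Rogawski1990

end
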